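import Summits.CriticalPhenomena.Ising3D.Control2DL19GapCData109
import Summits.CriticalPhenomena.Ising3D.Control2DL19GapCData110
import Summits.CriticalPhenomena.Ising3D.Control2DL19GapCData111
import Summits.CriticalPhenomena.Ising3D.Control2DL19GapCData112
import Summits.CriticalPhenomena.Ising3D.Control2DL19GapCData113
import Summits.CriticalPhenomena.Ising3D.Control2DL19GapCData114
import Mathlib.Tactic.Linarith
import Mathlib.Tactic.NormNum
import HarnessLib

/-!
# Kernel replay of the RB-1 certificate `j129766_functional_deriv2d_L19_E048_eps1.00005.json` (Λ = 19, E₀ = 48): Δ_ε < 20001/20000 at Δ_σ = 1/8: cell lemmas of spins 2, 4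
(cell `pub-ising3x`, seat controls-1 gen 19; KERNEL PATH for the 2D γ-certificates, Λ = 19 — CONTROL-ONLY)

HONEST FRAMING: lottery ticket; floor = tightest certified 3D Ising CFT bounds; no exact-solution
claim without a proof. CONTROL-ONLY (`d = 2`, `Δ_σ = 1/8`).

Per-spin cell lemmas `cellSpan_gapC_sℓ`: on the spin's Δ-range below `E₀ = 48` the certificate functional is non-negative on the
truncated block `QN (Nd+1) ℓ Δ`, chained from the kernel-decided Bernstein leaves of `Control2DL19GapCData*` via
`cell_nonneg_of_bernAuto_trunc` (case split along the leaf boundaries). `Control2DL19GapCCells` assembles them into `cells_gapC`.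
No facts, standard axioms only.
-/

namespace Summit.CriticalPhenomena.Ising3D.Control2D

open Finset Set
open Literature.MathematicalPhysics.QuantumFieldTheory.ConformalBootstrap3D

set_option maxHeartbeats 0 in
set_option maxRecDepth 200000 in
/-- **Cell lemma of spin 2** (`Δ ∈ [2, 48]`, truncation `N = 71 + 1`): the certificate functional is `≥ 0` on the
truncated block, from the kernel-decided Bernstein leaves (19). [folklore] -/
theorem cellSpan_gapC_s2 {Δ : ℝ} (h1 : (2 : ℝ) ≤ Δ) (h2 : Δ ≤ 48) :
    0 ≤ taylorFunctional2D (1 / 2) slL19.toFinset (fun p => (wtgapC p : ℝ))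
      (crossF (1 / 8) (-1) (QN (71 + 1) 2 Δ)) := by
  rcases le_or_gt Δ ((39 : ℝ) / 8) with hd0 | hd0
  · exact cell_nonneg_of_bernAuto_trunc wtgapC slL19_nodup slL19_deg 2 71 507 (q := 16) (a := 0)
      (L := 23) (by norm_num) (by norm_num) (by norm_num) (by rw [phatgapCs2_eq]; exact cellChk_gapC_s2l0)
      (by norm_num; linarith) (by norm_num; linarith)
  rcases le_or_gt Δ ((179 : ℝ) / 32) with hd1 | hd1
  · exact cell_nonneg_of_bernAuto_trunc wtgapC slL19_nodup slL19_deg 2 71 507 (q := 64) (a := 92)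
      (L := 23) (by norm_num) (by norm_num) (by norm_num) (by rw [phatgapCs2_eq]; exact cellChk_gapC_s2l1)
      (by norm_num; linarith) (by norm_num; linarith)
  rcases le_or_gt Δ ((381 : ℝ) / 64) with hd2 | hd2
  · exact cell_nonneg_of_bernAuto_trunc wtgapC slL19_nodup slL19_deg 2 71 507 (q := 128) (a := 230)
      (L := 23) (by norm_num) (by norm_num) (by norm_num) (by rw [phatgapCs2_eq]; exact cellChk_gapC_s2l2)
      (by norm_num; linarith) (by norm_num; linarith)
  rcases le_or_gt Δ ((101 : ℝ) / 16) with hd3 | hd3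
  · exact cell_nonneg_of_bernAuto_trunc wtgapC slL19_nodup slL19_deg 2 71 507 (q := 128) (a := 253)
      (L := 23) (by norm_num) (by norm_num) (by norm_num) (by rw [phatgapCs2_eq]; exact cellChk_gapC_s2l3)
      (by norm_num; linarith) (by norm_num; linarith)
  rcases le_or_gt Δ ((31 : ℝ) / 4) with hd4 | hd4
  · exact cell_nonneg_of_bernAuto_trunc wtgapC slL19_nodup slL19_deg 2 71 507 (q := 32) (a := 69)
      (L := 23) (by norm_num) (by norm_num) (by norm_num) (by rw [phatgapCs2_eq]; exact cellChk_gapC_s2l4)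
      (by norm_num; linarith) (by norm_num; linarith)
  rcases le_or_gt Δ ((519 : ℝ) / 64) with hd5 | hd5
  · exact cell_nonneg_of_bernAuto_trunc wtgapC slL19_nodup slL19_deg 2 71 507 (q := 128) (a := 368)
      (L := 23) (by norm_num) (by norm_num) (by norm_num) (by rw [phatgapCs2_eq]; exact cellChk_gapC_s2l5)
      (by norm_num; linarith) (by norm_num; linarith)
  rcases le_or_gt Δ ((1061 : ℝ) / 128) with hd6 | hd6
  · exact cell_nonneg_of_bernAuto_trunc wtgapC slL19_nodup slL19_deg 2 71 507 (q := 256) (a := 782)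
      (L := 23) (by norm_num) (by norm_num) (by norm_num) (by rw [phatgapCs2_eq]; exact cellChk_gapC_s2l6)
      (by norm_num; linarith) (by norm_num; linarith)
  rcases le_or_gt Δ ((271 : ℝ) / 32) with hd7 | hd7
  · exact cell_nonneg_of_bernAuto_trunc wtgapC slL19_nodup slL19_deg 2 71 507 (q := 256) (a := 805)
      (L := 23) (by norm_num) (by norm_num) (by norm_num) (by rw [phatgapCs2_eq]; exact cellChk_gapC_s2l7)
      (by norm_num; linarith) (by norm_num; linarith)
  rcases le_or_gt Δ ((147 : ℝ) / 16) with hd8 | hd8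
  · exact cell_nonneg_of_bernAuto_trunc wtgapC slL19_nodup slL19_deg 2 71 507 (q := 64) (a := 207)
      (L := 23) (by norm_num) (by norm_num) (by norm_num) (by rw [phatgapCs2_eq]; exact cellChk_gapC_s2l8)
      (by norm_num; linarith) (by norm_num; linarith)
  rcases le_or_gt Δ ((85 : ℝ) / 8) with hd9 | hd9
  · exact cell_nonneg_of_bernAuto_trunc wtgapC slL19_nodup slL19_deg 2 71 507 (q := 32) (a := 115)
      (L := 23) (by norm_num) (by norm_num) (by norm_num) (by rw [phatgapCs2_eq]; exact cellChk_gapC_s2l9)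
      (by norm_num; linarith) (by norm_num; linarith)
  rcases le_or_gt Δ ((193 : ℝ) / 16) with hd10 | hd10
  · exact cell_nonneg_of_bernAuto_trunc wtgapC slL19_nodup slL19_deg 2 71 497 (q := 32) (a := 138)
      (L := 23) (by norm_num) (by norm_num) (by norm_num) (by rw [phatgapCs2_eq]; exact cellChk_gapC_s2l10)
      (by norm_num; linarith) (by norm_num; linarith)
  rcases le_or_gt Δ ((795 : ℝ) / 64) with hd11 | hd11
  · exact cell_nonneg_of_bernAuto_trunc wtgapC slL19_nodup slL19_deg 2 71 497 (q := 128) (a := 644)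
      (L := 23) (by norm_num) (by norm_num) (by norm_num) (by rw [phatgapCs2_eq]; exact cellChk_gapC_s2l11)
      (by norm_num; linarith) (by norm_num; linarith)
  rcases le_or_gt Δ ((3203 : ℝ) / 256) with hd12 | hd12
  · exact cell_nonneg_of_bernAuto_trunc wtgapC slL19_nodup slL19_deg 2 71 487 (q := 512) (a := 2668)
      (L := 23) (by norm_num) (by norm_num) (by norm_num) (by rw [phatgapCs2_eq]; exact cellChk_gapC_s2l12)
      (by norm_num; linarith) (by norm_num; linarith)
  rcases le_or_gt Δ ((6429 : ℝ) / 512) with hd13 | hd13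
  · exact cell_nonneg_of_bernAuto_trunc wtgapC slL19_nodup slL19_deg 2 71 487 (q := 1024) (a := 5382)
      (L := 23) (by norm_num) (by norm_num) (by norm_num) (by rw [phatgapCs2_eq]; exact cellChk_gapC_s2l13)
      (by norm_num; linarith) (by norm_num; linarith)
  rcases le_or_gt Δ ((1613 : ℝ) / 128) with hd14 | hd14
  · exact cell_nonneg_of_bernAuto_trunc wtgapC slL19_nodup slL19_deg 2 71 477 (q := 1024) (a := 5405)
      (L := 23) (by norm_num) (by norm_num) (by norm_num) (by rw [phatgapCs2_eq]; exact cellChk_gapC_s2l14)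
      (by norm_num; linarith) (by norm_num; linarith)
  rcases le_or_gt Δ ((409 : ℝ) / 32) with hd15 | hd15
  · exact cell_nonneg_of_bernAuto_trunc wtgapC slL19_nodup slL19_deg 2 71 487 (q := 256) (a := 1357)
      (L := 23) (by norm_num) (by norm_num) (by norm_num) (by rw [phatgapCs2_eq]; exact cellChk_gapC_s2l15)
      (by norm_num; linarith) (by norm_num; linarith)
  rcases le_or_gt Δ ((27 : ℝ) / 2) with hd16 | hd16
  · exact cell_nonneg_of_bernAuto_trunc wtgapC slL19_nodup slL19_deg 2 71 497 (q := 64) (a := 345)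
      (L := 23) (by norm_num) (by norm_num) (by norm_num) (by rw [phatgapCs2_eq]; exact cellChk_gapC_s2l16)
      (by norm_num; linarith) (by norm_num; linarith)
  rcases le_or_gt Δ (25 : ℝ) with hd17 | hd17
  · exact cell_nonneg_of_bernAuto_trunc wtgapC slL19_nodup slL19_deg 2 71 497 (q := 4) (a := 23)
      (L := 23) (by norm_num) (by norm_num) (by norm_num) (by rw [phatgapCs2_eq]; exact cellChk_gapC_s2l17)
      (by norm_num; linarith) (by norm_num; linarith)
  exact cell_nonneg_of_bernAuto_trunc wtgapC slL19_nodup slL19_deg 2 71 507 (q := 2) (a := 23)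
      (L := 23) (by norm_num) (by norm_num) (by norm_num) (by rw [phatgapCs2_eq]; exact cellChk_gapC_s2l18)
      (by norm_num; linarith) (by norm_num; linarith)

set_option maxHeartbeats 0 in
set_option maxRecDepth 200000 in
/-- **Cell lemma of spin 4** (`Δ ∈ [4, 48]`, truncation `N = 71 + 1`): the certificate functional is `≥ 0` on the
truncated block, from the kernel-decided Bernstein leaves (15). [folklore] -/
theorem cellSpan_gapC_s4 {Δ : ℝ} (h1 : (4 : ℝ) ≤ Δ) (h2 : Δ ≤ 48) :
    0 ≤ taylorFunctional2D (1 / 2) slL19.toFinset (fun p => (wtgapC p : ℝ))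
      (crossF (1 / 8) (-1) (QN (71 + 1) 4 Δ)) := by
  rcases le_or_gt Δ ((75 : ℝ) / 16) with hd0 | hd0
  · exact cell_nonneg_of_bernAuto_trunc wtgapC slL19_nodup slL19_deg 4 71 511 (q := 32) (a := 0)
      (L := 11) (by norm_num) (by norm_num) (by norm_num) (by rw [phatgapCs4_eq]; exact cellChk_gapC_s4l0)
      (by norm_num; linarith) (by norm_num; linarith)
  rcases le_or_gt Δ ((161 : ℝ) / 32) with hd1 | hd1
  · exact cell_nonneg_of_bernAuto_trunc wtgapC slL19_nodup slL19_deg 4 71 511 (q := 64) (a := 22)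
      (L := 11) (by norm_num) (by norm_num) (by norm_num) (by rw [phatgapCs4_eq]; exact cellChk_gapC_s4l1)
      (by norm_num; linarith) (by norm_num; linarith)
  rcases le_or_gt Δ ((43 : ℝ) / 8) with hd2 | hd2
  · exact cell_nonneg_of_bernAuto_trunc wtgapC slL19_nodup slL19_deg 4 71 511 (q := 64) (a := 33)
      (L := 11) (by norm_num) (by norm_num) (by norm_num) (by rw [phatgapCs4_eq]; exact cellChk_gapC_s4l2)
      (by norm_num; linarith) (by norm_num; linarith)
  rcases le_or_gt Δ ((27 : ℝ) / 4) with hd3 | hd3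
  · exact cell_nonneg_of_bernAuto_trunc wtgapC slL19_nodup slL19_deg 4 71 511 (q := 16) (a := 11)
      (L := 11) (by norm_num) (by norm_num) (by norm_num) (by rw [phatgapCs4_eq]; exact cellChk_gapC_s4l3)
      (by norm_num; linarith) (by norm_num; linarith)
  rcases le_or_gt Δ ((65 : ℝ) / 8) with hd4 | hd4
  · exact cell_nonneg_of_bernAuto_trunc wtgapC slL19_nodup slL19_deg 4 71 511 (q := 16) (a := 22)
      (L := 11) (by norm_num) (by norm_num) (by norm_num) (by rw [phatgapCs4_eq]; exact cellChk_gapC_s4l4)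
      (by norm_num; linarith) (by norm_num; linarith)
  rcases le_or_gt Δ ((19 : ℝ) / 2) with hd5 | hd5
  · exact cell_nonneg_of_bernAuto_trunc wtgapC slL19_nodup slL19_deg 4 71 511 (q := 16) (a := 33)
      (L := 11) (by norm_num) (by norm_num) (by norm_num) (by rw [phatgapCs4_eq]; exact cellChk_gapC_s4l5)
      (by norm_num; linarith) (by norm_num; linarith)
  rcases le_or_gt Δ ((87 : ℝ) / 8) with hd6 | hd6
  · exact cell_nonneg_of_bernAuto_trunc wtgapC slL19_nodup slL19_deg 4 71 511 (q := 16) (a := 44)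
      (L := 11) (by norm_num) (by norm_num) (by norm_num) (by rw [phatgapCs4_eq]; exact cellChk_gapC_s4l6)
      (by norm_num; linarith) (by norm_num; linarith)
  rcases le_or_gt Δ ((185 : ℝ) / 16) with hd7 | hd7
  · exact cell_nonneg_of_bernAuto_trunc wtgapC slL19_nodup slL19_deg 4 71 511 (q := 32) (a := 110)
      (L := 11) (by norm_num) (by norm_num) (by norm_num) (by rw [phatgapCs4_eq]; exact cellChk_gapC_s4l7)
      (by norm_num; linarith) (by norm_num; linarith)
  rcases le_or_gt Δ ((381 : ℝ) / 32) with hd8 | hd8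
  · exact cell_nonneg_of_bernAuto_trunc wtgapC slL19_nodup slL19_deg 4 71 511 (q := 64) (a := 242)
      (L := 11) (by norm_num) (by norm_num) (by norm_num) (by rw [phatgapCs4_eq]; exact cellChk_gapC_s4l8)
      (by norm_num; linarith) (by norm_num; linarith)
  rcases le_or_gt Δ ((1535 : ℝ) / 128) with hd9 | hd9
  · exact cell_nonneg_of_bernAuto_trunc wtgapC slL19_nodup slL19_deg 4 71 511 (q := 256) (a := 1012)
      (L := 11) (by norm_num) (by norm_num) (by norm_num) (by rw [phatgapCs4_eq]; exact cellChk_gapC_s4l9)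
      (by norm_num; linarith) (by norm_num; linarith)
  rcases le_or_gt Δ ((773 : ℝ) / 64) with hd10 | hd10
  · exact cell_nonneg_of_bernAuto_trunc wtgapC slL19_nodup slL19_deg 4 71 491 (q := 256) (a := 1023)
      (L := 11) (by norm_num) (by norm_num) (by norm_num) (by rw [phatgapCs4_eq]; exact cellChk_gapC_s4l10)
      (by norm_num; linarith) (by norm_num; linarith)
  rcases le_or_gt Δ ((49 : ℝ) / 4) with hd11 | hd11
  · exact cell_nonneg_of_bernAuto_trunc wtgapC slL19_nodup slL19_deg 4 71 511 (q := 128) (a := 517)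
      (L := 11) (by norm_num) (by norm_num) (by norm_num) (by rw [phatgapCs4_eq]; exact cellChk_gapC_s4l11)
      (by norm_num; linarith) (by norm_num; linarith)
  rcases le_or_gt Δ (15 : ℝ) with hd12 | hd12
  · exact cell_nonneg_of_bernAuto_trunc wtgapC slL19_nodup slL19_deg 4 71 511 (q := 8) (a := 33)
      (L := 11) (by norm_num) (by norm_num) (by norm_num) (by rw [phatgapCs4_eq]; exact cellChk_gapC_s4l12)
      (by norm_num; linarith) (by norm_num; linarith)
  rcases le_or_gt Δ (26 : ℝ) with hd13 | hd13
  · exact cell_nonneg_of_bernAuto_trunc wtgapC slL19_nodup slL19_deg 4 71 511 (q := 2) (a := 11)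
      (L := 11) (by norm_num) (by norm_num) (by norm_num) (by rw [phatgapCs4_eq]; exact cellChk_gapC_s4l13)
      (by norm_num; linarith) (by norm_num; linarith)
  exact cell_nonneg_of_bernAuto_trunc wtgapC slL19_nodup slL19_deg 4 71 511 (q := 1) (a := 11)
      (L := 11) (by norm_num) (by norm_num) (by norm_num) (by rw [phatgapCs4_eq]; exact cellChk_gapC_s4l14)
      (by norm_num; linarith) (by norm_num; linarith)

end Summit.CriticalPhenomena.Ising3D.Control2D
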